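import Summits.QuantumFields.BalabanUV.T4Continuum.Support.NE7LawLevelPredictor

/-!
# NE7, ROAD P4 (law-level): the ABSORPTION INEQUALITIES — defects booked through their own reverse martingales

(Cell `pub-balaban`, sub-cell `t4`, binder row NE7 = node U5, co-owner #4 `b2b-balaban-t4-ne7-p4`, gen 5; skeleton
`HOME/t4/skeletons/NE7-t4-ne7-p4.md` §2 NODE Q.old (v1.11) and `HOME/t4/b2b-balaban-t4-ne7-p4/g5/BOOKING-H-NE7-P4.md`
§2, §5.  Imports the road's `NE7LawLevelPredictor` (`resid_ae_eq_sum`, `incr_ae_eq_cfluct_add`; the notation cfluct ∕ resid ∕ defect is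
inlined there and here — no definitions), hence
`NE7LawLevelLabelled` (`sum_integral_incr_sq_le`), `NE7LawLevelOldLayers` (p209362) and row NE1′'s [folklore]
`T4MeanChannel`, BY NAME.)

HONEST FRAMING (T4-DAG PAGE 1).  Rung (B)+1 on ONE FIXED finite four-torus, CONDITIONAL on `BetaPertH` and the nine
spine estimates (0/9 proved); NOT infinite volume, NOT a mass gap, NOT the Clay problem.  NE7 is NOT PRINTED and NOT
proved here; every theorem below is [folklore] measure theory over plain probabilistic data, sorry-free; no statement
of the audited series ([Balaban1988Convergent], [Balaban1989LargeFieldI], [Balaban1989LargeFieldII]) is asserted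
or used; NOT summit progress.

WHAT THIS FILE DOES.  From `incr S j = cfluct A j + incr (resid 0) j + Σ_{m<j} incr (defect m) j` (companion file):
§1 `integral_incr_sq_le_three` (one layer), `absorption_fine` (increments kept — THE FORM NODE Q.old's COUNT USES:
every right-hand term is a one-step conditional variance, booked diagonally by the layer's Poincaré ∕ oscillation
inequality under the fixed-term fibre law of the label):
  `Σ_{j<d} ∫ (incr S j)² ≤ 3Σ_{j<d} ∫ (cfluct A j)² + 3Σ_{j<d} ∫ (incr (resid 0) j)² + 3d·Σ_{m<d} Σ_{j<d} ∫ (incr (defect m) j)²`,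
its contraction `absorption` (each reverse martingale contracted to its birth second moment by
`sum_integral_incr_sq_le` — adequate whenever raw birth second moments are affordable), and the MEAN TERM with a
predictor `integral_condExp_sq_le_three`
  `∫ (μ[S|F d])² ≤ 3∫ (A d)² + 3∫ (μ[resid 0|F d])² + 3d·Σ_{m<d} ∫ (μ[defect m|F d])²`
(DICTIONARY: the unit layer given the label; each conditional mean vanishes at a flat unit field by covariance, term
by term, and is curvature-suppressed — BOOKING-H §5).  §2: the layer-SUM form of the L¹ bound
(`integral_abs_le_sqrt_of_sumLayerBudget`, all that `OldLayerDatum.bracket` uses) and NODE Q.old with absorption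
(`integral_abs_le_sqrt_of_absorption`).  WHY THIS RETIRES (QL-a-LF) «the R-step twin of the source-response lemma»
(skeleton v1.10.3): the defects — born where a large-field region of the label meets the support — enter through
second moments of their OWN conditional fluctuations and their unit-layer conditional means; no analyticity,
localisation expansion or constants' linearity of a large-field fibre mean is used at birth (BOOKING-H §4: birth SIZE
by pathwise oscillation), and after birth the region-attached structure is that of the printed B′-pieces (BOOKING-H
§4 (4d)).  Nothing here is an estimate about Bałaban's chain; the budgets remain binders.
-/

noncomputable section

open MeasureTheory Finset Filter
open scoped BigOperators

namespace Summit.QuantumFields.BalabanUV.T4Continuum.NE7LawLevel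

open Literature.MathematicalPhysics.QuantumFieldTheory.Balaban1983to89
open Literature.MathematicalPhysics.QuantumFieldTheory.Balaban1983to89.T4MeanChannel

variable {Ω : Type*} {mΩ : MeasurableSpace Ω} {μ : Measure Ω} {F : ℕ → MeasurableSpace Ω}

/-! ## §1 The absorption inequalities -/

section Absorption

variable (hF : Antitone F) (hFle : ∀ j, F j ≤ mΩ) {S : Ω → ℝ}
  {B : ℝ} (hSb : ∀ ω, |S ω| ≤ B) {A : ℕ → Ω → ℝ} (hAm : ∀ j, StronglyMeasurable[F j] (A j)) {R : ℝ}
  (hAb : ∀ j ω, |A j ω| ≤ R)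

include hF hFle hSb hAm hAb in
/-- **ONE LAYER:** `∫ (incr S j)² ≤ 3∫ (cfluct A j)² + 3∫ (incr (resid 0) j)² + 3·j·Σ_{m<j} ∫ (incr (defect m) j)²`.
[folklore] -/
theorem integral_incr_sq_le_three [IsFiniteMeasure μ] (j : ℕ) :
    ∫ ω, incr μ F S j ω ^ 2 ∂μ ≤ 3 * ∫ ω, (A j - μ[A j|F (j + 1)]) ω ^ 2 ∂μ +
      3 * ∫ ω, incr μ F ((μ[S|F 0] - A 0)) j ω ^ 2 ∂μ +
      3 * (j * ∑ m ∈ range j, ∫ ω, incr μ F ((μ[A m|F (m + 1)] - A (m + 1))) j ω ^ 2 ∂μ) := by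
  -- integrability of all squares (everything is a.e. bounded on a finite measure space)
  have hIa : Integrable (fun ω => (A j - μ[A j|F (j + 1)]) ω ^ 2) μ :=
    integrable_sq_of_ae_abs_le (((hAm j).mono (hFle j)).aestronglyMeasurable.sub
      (stronglyMeasurable_condExp.mono (hFle (j + 1))).aestronglyMeasurable) (ae_abs_cfluct_le hAb j)
  have hIb : Integrable (fun ω => incr μ F ((μ[S|F 0] - A 0)) j ω ^ 2) μ :=
    integrable_sq_of_ae_abs_le (aestronglyMeasurable_incr hF hFle _ j)
      (ae_abs_incr_le_of_ae (ae_abs_resid_zero_le hSb hAb) j)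
  have hIc : ∀ m, Integrable (fun ω => incr μ F ((μ[A m|F (m + 1)] - A (m + 1))) j ω ^ 2) μ := fun m =>
    integrable_sq_of_ae_abs_le (aestronglyMeasurable_incr hF hFle _ j)
      (ae_abs_incr_le_of_ae (ae_abs_defect_le hAb m) j)
  have hIS : Integrable (fun ω => incr μ F S j ω ^ 2) μ :=
    integrable_sq_of_ae_abs_le (aestronglyMeasurable_incr hF hFle _ j) (ae_abs_incr_le hSb j)
  have hIsum : Integrable (fun ω => ∑ m ∈ range j, incr μ F ((μ[A m|F (m + 1)] - A (m + 1))) j ω ^ 2) μ :=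
    integrable_finsetSum _ fun m _ => hIc m
  -- pointwise (a.e.) bound
  have hpt : ∀ᵐ ω ∂μ, incr μ F S j ω ^ 2 ≤ 3 * (A j - μ[A j|F (j + 1)]) ω ^ 2 +
      3 * incr μ F ((μ[S|F 0] - A 0)) j ω ^ 2 +
      3 * (j * ∑ m ∈ range j, incr μ F ((μ[A m|F (m + 1)] - A (m + 1))) j ω ^ 2) := by
    filter_upwards [incr_ae_eq_cfluct_add (μ := μ) (S := S) hF hFle hAm hAb j] with ω e
    rw [e, Pi.add_apply, Pi.add_apply, Finset.sum_apply]
    have hcs : (∑ m ∈ range j, incr μ F ((μ[A m|F (m + 1)] - A (m + 1))) j ω) ^ 2 ≤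
        j * ∑ m ∈ range j, incr μ F ((μ[A m|F (m + 1)] - A (m + 1))) j ω ^ 2 := by
      have h := sq_sum_le_card_mul_sum_sq (s := range j) (f := fun m => incr μ F ((μ[A m|F (m + 1)] - A (m + 1))) j ω)
      rwa [card_range] at h
    have h3 : ∀ a b c : ℝ, (a + b + c) ^ 2 ≤ 3 * (a ^ 2 + b ^ 2 + c ^ 2) := fun a b c => by
      nlinarith [sq_nonneg (a - b), sq_nonneg (b - c), sq_nonneg (a - c)]
    nlinarith [h3 ((A j - μ[A j|F (j + 1)]) ω) (incr μ F ((μ[S|F 0] - A 0)) j ω)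
      (∑ m ∈ range j, incr μ F ((μ[A m|F (m + 1)] - A (m + 1))) j ω), hcs]
  calc ∫ ω, incr μ F S j ω ^ 2 ∂μ
        ≤ ∫ ω, (3 * (A j - μ[A j|F (j + 1)]) ω ^ 2 + 3 * incr μ F ((μ[S|F 0] - A 0)) j ω ^ 2 +
            3 * (j * ∑ m ∈ range j, incr μ F ((μ[A m|F (m + 1)] - A (m + 1))) j ω ^ 2)) ∂μ :=
          integral_mono_ae hIS ((hIa.const_mul 3).add (hIb.const_mul 3) |>.add
            ((hIsum.const_mul _).const_mul 3)) hpt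
    _ = 3 * ∫ ω, (A j - μ[A j|F (j + 1)]) ω ^ 2 ∂μ + 3 * ∫ ω, incr μ F ((μ[S|F 0] - A 0)) j ω ^ 2 ∂μ +
          3 * (j * ∑ m ∈ range j, ∫ ω, incr μ F ((μ[A m|F (m + 1)] - A (m + 1))) j ω ^ 2 ∂μ) := by
          have hA : Integrable (fun ω => 3 * (A j - μ[A j|F (j + 1)]) ω ^ 2 + 3 * incr μ F ((μ[S|F 0] - A 0)) j ω ^ 2) μ :=
            (hIa.const_mul 3).add (hIb.const_mul 3)
          have hB : Integrable (fun ω => 3 * ((j : ℝ) * ∑ m ∈ range j, incr μ F ((μ[A m|F (m + 1)] - A (m + 1))) j ω ^ 2)) μ :=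
            (hIsum.const_mul _).const_mul 3
          have e1 : ∫ ω, (3 * (A j - μ[A j|F (j + 1)]) ω ^ 2 + 3 * incr μ F ((μ[S|F 0] - A 0)) j ω ^ 2 +
              3 * (j * ∑ m ∈ range j, incr μ F ((μ[A m|F (m + 1)] - A (m + 1))) j ω ^ 2)) ∂μ =
              ∫ ω, (3 * (A j - μ[A j|F (j + 1)]) ω ^ 2 + 3 * incr μ F ((μ[S|F 0] - A 0)) j ω ^ 2) ∂μ +
              ∫ ω, 3 * ((j : ℝ) * ∑ m ∈ range j, incr μ F ((μ[A m|F (m + 1)] - A (m + 1))) j ω ^ 2) ∂μ := integral_add hA hB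
          have e2 : ∫ ω, (3 * (A j - μ[A j|F (j + 1)]) ω ^ 2 + 3 * incr μ F ((μ[S|F 0] - A 0)) j ω ^ 2) ∂μ =
              ∫ ω, 3 * (A j - μ[A j|F (j + 1)]) ω ^ 2 ∂μ + ∫ ω, 3 * incr μ F ((μ[S|F 0] - A 0)) j ω ^ 2 ∂μ :=
            integral_add (hIa.const_mul 3) (hIb.const_mul 3)
          have e3 : ∫ ω, (j : ℝ) * ∑ m ∈ range j, incr μ F ((μ[A m|F (m + 1)] - A (m + 1))) j ω ^ 2 ∂μ =
              (j : ℝ) * ∑ m ∈ range j, ∫ ω, incr μ F ((μ[A m|F (m + 1)] - A (m + 1))) j ω ^ 2 ∂μ := by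
            rw [integral_const_mul, integral_finsetSum _ fun m _ => hIc m]
          rw [e1, e2, integral_const_mul, integral_const_mul, integral_const_mul, e3]

include hF hFle hSb hAm hAb in
/-- **ABSORPTION, FINE FORM (increments kept).**  For every depth `d`:
`Σ_{j<d} ∫ (incr S j)² ≤ 3·Σ_{j<d} ∫ (cfluct A j)² + 3·Σ_{j<d} ∫ (incr (resid 0) j)² + 3d·Σ_{m<d} Σ_{j<d} ∫ (incr (defect m) j)²`.
Every term on the right is a ONE-STEP CONDITIONAL VARIANCE (of the predictor, of the initial residual's reverse
martingale, of each defect's reverse martingale) — DICTIONARY: each is booked by the layer's Poincaré ∕ oscillation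
inequality under the fixed-term fibre law, diagonally across far-apart bonds; no raw second moment of a defect (whose
squared MEAN would add coherently over the label's regions) appears.  This is the form NODE Q.old's count uses
(BOOKING-H §5); `absorption` below contracts it further. [folklore] -/
theorem absorption_fine [IsFiniteMeasure μ] (d : ℕ) :
    ∑ j ∈ range d, ∫ ω, incr μ F S j ω ^ 2 ∂μ ≤ 3 * ∑ j ∈ range d, ∫ ω, (A j - μ[A j|F (j + 1)]) ω ^ 2 ∂μ +
      3 * ∑ j ∈ range d, ∫ ω, incr μ F ((μ[S|F 0] - A 0)) j ω ^ 2 ∂μ +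
      3 * d * ∑ m ∈ range d, ∑ j ∈ range d, ∫ ω, incr μ F ((μ[A m|F (m + 1)] - A (m + 1))) j ω ^ 2 ∂μ := by
  have hstep := fun j => integral_incr_sq_le_three (μ := μ) (S := S) hF hFle hSb hAm hAb j
  have hnn : ∀ m j, 0 ≤ ∫ ω, incr μ F ((μ[A m|F (m + 1)] - A (m + 1))) j ω ^ 2 ∂μ := fun m j => integral_nonneg fun _ => sq_nonneg _
  have hdouble : ∑ j ∈ range d, ((j : ℝ) * ∑ m ∈ range j, ∫ ω, incr μ F ((μ[A m|F (m + 1)] - A (m + 1))) j ω ^ 2 ∂μ) ≤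
      d * ∑ m ∈ range d, ∑ j ∈ range d, ∫ ω, incr μ F ((μ[A m|F (m + 1)] - A (m + 1))) j ω ^ 2 ∂μ := by
    calc ∑ j ∈ range d, ((j : ℝ) * ∑ m ∈ range j, ∫ ω, incr μ F ((μ[A m|F (m + 1)] - A (m + 1))) j ω ^ 2 ∂μ)
          ≤ ∑ j ∈ range d, ((d : ℝ) * ∑ m ∈ range d, ∫ ω, incr μ F ((μ[A m|F (m + 1)] - A (m + 1))) j ω ^ 2 ∂μ) := by
            refine sum_le_sum fun j hj => ?_
            have hjd : (j : ℝ) ≤ d := by exact_mod_cast (mem_range.mp hj).le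
            have hsub : ∑ m ∈ range j, ∫ ω, incr μ F ((μ[A m|F (m + 1)] - A (m + 1))) j ω ^ 2 ∂μ ≤
                ∑ m ∈ range d, ∫ ω, incr μ F ((μ[A m|F (m + 1)] - A (m + 1))) j ω ^ 2 ∂μ :=
              sum_le_sum_of_subset_of_nonneg (range_mono (mem_range.mp hj).le) fun m _ _ => hnn m j
            exact mul_le_mul hjd hsub (sum_nonneg fun m _ => hnn m j) (Nat.cast_nonneg d)
      _ = (d : ℝ) * ∑ m ∈ range d, ∑ j ∈ range d, ∫ ω, incr μ F ((μ[A m|F (m + 1)] - A (m + 1))) j ω ^ 2 ∂μ := by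
            rw [← mul_sum, sum_comm]
  calc ∑ j ∈ range d, ∫ ω, incr μ F S j ω ^ 2 ∂μ
        ≤ ∑ j ∈ range d, (3 * ∫ ω, (A j - μ[A j|F (j + 1)]) ω ^ 2 ∂μ + 3 * ∫ ω, incr μ F ((μ[S|F 0] - A 0)) j ω ^ 2 ∂μ +
            3 * (j * ∑ m ∈ range j, ∫ ω, incr μ F ((μ[A m|F (m + 1)] - A (m + 1))) j ω ^ 2 ∂μ)) := sum_le_sum fun j _ => hstep j
    _ = 3 * ∑ j ∈ range d, ∫ ω, (A j - μ[A j|F (j + 1)]) ω ^ 2 ∂μ +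
          3 * ∑ j ∈ range d, ∫ ω, incr μ F ((μ[S|F 0] - A 0)) j ω ^ 2 ∂μ +
          3 * ∑ j ∈ range d, ((j : ℝ) * ∑ m ∈ range j, ∫ ω, incr μ F ((μ[A m|F (m + 1)] - A (m + 1))) j ω ^ 2 ∂μ) := by
          rw [sum_add_distrib, sum_add_distrib, mul_sum, mul_sum, mul_sum]
    _ ≤ _ := by
          have := mul_le_mul_of_nonneg_left hdouble (by norm_num : (0 : ℝ) ≤ 3)
          rw [mul_assoc]
          linarith

include hF hFle hSb hAm hAb in
/-- **ABSORPTION.**  For every depth `d`: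
`Σ_{j<d} ∫ (incr S j)² ≤ 3·Σ_{j<d} ∫ (cfluct A j)² + 3·∫ (resid 0)² + 3d·Σ_{m<d} ∫ (defect m)²`.
The structured predictor pays per layer through its one-step conditional fluctuation; the initial residual and every
defect pay ONCE, by their second moment at birth (`sum_integral_incr_sq_le`), with the factor `3d` (DICTIONARY: `d` = the age `n`, a
logarithmic quantity in the window — `poly(n)` is free in NODE Q.old's count). [folklore] -/
theorem absorption [IsFiniteMeasure μ] (d : ℕ) :
    ∑ j ∈ range d, ∫ ω, incr μ F S j ω ^ 2 ∂μ ≤ 3 * ∑ j ∈ range d, ∫ ω, (A j - μ[A j|F (j + 1)]) ω ^ 2 ∂μ +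
      3 * ∫ ω, (μ[S|F 0] - A 0) ω ^ 2 ∂μ + 3 * d * ∑ m ∈ range d, ∫ ω, (μ[A m|F (m + 1)] - A (m + 1)) ω ^ 2 ∂μ := by
  have hstep := fun j => integral_incr_sq_le_three (μ := μ) (S := S) hF hFle hSb hAm hAb j
  have hres : ∑ j ∈ range d, ∫ ω, incr μ F ((μ[S|F 0] - A 0)) j ω ^ 2 ∂μ ≤ ∫ ω, (μ[S|F 0] - A 0) ω ^ 2 ∂μ :=
    sum_integral_incr_sq_le hF hFle ((stronglyMeasurable_resid hAm 0).mono (hFle 0)).aestronglyMeasurable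
      (ae_abs_resid_zero_le hSb hAb) d
  have hdef : ∀ m, ∑ j ∈ range d, ∫ ω, incr μ F ((μ[A m|F (m + 1)] - A (m + 1))) j ω ^ 2 ∂μ ≤ ∫ ω, (μ[A m|F (m + 1)] - A (m + 1)) ω ^ 2 ∂μ :=
    fun m => sum_integral_incr_sq_le hF hFle
      ((stronglyMeasurable_defect hAm m).mono (hFle (m + 1))).aestronglyMeasurable
      (ae_abs_defect_le hAb m) d
  have hnn : ∀ m j, 0 ≤ ∫ ω, incr μ F ((μ[A m|F (m + 1)] - A (m + 1))) j ω ^ 2 ∂μ := fun m j => integral_nonneg fun _ => sq_nonneg _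
  -- the double sum: `Σ_{j<d} j·Σ_{m<j} a m j ≤ d·Σ_{m<d} Σ_{j<d} a m j ≤ d·Σ_{m<d} ∫ (defect m)²`
  have hdouble : ∑ j ∈ range d, ((j : ℝ) * ∑ m ∈ range j, ∫ ω, incr μ F ((μ[A m|F (m + 1)] - A (m + 1))) j ω ^ 2 ∂μ) ≤
      d * ∑ m ∈ range d, ∫ ω, (μ[A m|F (m + 1)] - A (m + 1)) ω ^ 2 ∂μ := by
    calc ∑ j ∈ range d, ((j : ℝ) * ∑ m ∈ range j, ∫ ω, incr μ F ((μ[A m|F (m + 1)] - A (m + 1))) j ω ^ 2 ∂μ)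
          ≤ ∑ j ∈ range d, ((d : ℝ) * ∑ m ∈ range d, ∫ ω, incr μ F ((μ[A m|F (m + 1)] - A (m + 1))) j ω ^ 2 ∂μ) := by
            refine sum_le_sum fun j hj => ?_
            have hjd : (j : ℝ) ≤ d := by exact_mod_cast (mem_range.mp hj).le
            have hsub : ∑ m ∈ range j, ∫ ω, incr μ F ((μ[A m|F (m + 1)] - A (m + 1))) j ω ^ 2 ∂μ ≤
                ∑ m ∈ range d, ∫ ω, incr μ F ((μ[A m|F (m + 1)] - A (m + 1))) j ω ^ 2 ∂μ :=
              sum_le_sum_of_subset_of_nonneg (range_mono (mem_range.mp hj).le) fun m _ _ => hnn m j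
            exact mul_le_mul hjd hsub (sum_nonneg fun m _ => hnn m j) (Nat.cast_nonneg d)
      _ = (d : ℝ) * ∑ m ∈ range d, ∑ j ∈ range d, ∫ ω, incr μ F ((μ[A m|F (m + 1)] - A (m + 1))) j ω ^ 2 ∂μ := by
            rw [← mul_sum, sum_comm]
      _ ≤ d * ∑ m ∈ range d, ∫ ω, (μ[A m|F (m + 1)] - A (m + 1)) ω ^ 2 ∂μ :=
            mul_le_mul_of_nonneg_left (sum_le_sum fun m _ => hdef m) (Nat.cast_nonneg d)
  calc ∑ j ∈ range d, ∫ ω, incr μ F S j ω ^ 2 ∂μ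
        ≤ ∑ j ∈ range d, (3 * ∫ ω, (A j - μ[A j|F (j + 1)]) ω ^ 2 ∂μ + 3 * ∫ ω, incr μ F ((μ[S|F 0] - A 0)) j ω ^ 2 ∂μ +
            3 * (j * ∑ m ∈ range j, ∫ ω, incr μ F ((μ[A m|F (m + 1)] - A (m + 1))) j ω ^ 2 ∂μ)) := sum_le_sum fun j _ => hstep j
    _ = 3 * ∑ j ∈ range d, ∫ ω, (A j - μ[A j|F (j + 1)]) ω ^ 2 ∂μ +
          3 * ∑ j ∈ range d, ∫ ω, incr μ F ((μ[S|F 0] - A 0)) j ω ^ 2 ∂μ +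
          3 * ∑ j ∈ range d, ((j : ℝ) * ∑ m ∈ range j, ∫ ω, incr μ F ((μ[A m|F (m + 1)] - A (m + 1))) j ω ^ 2 ∂μ) := by
          rw [sum_add_distrib, sum_add_distrib, mul_sum, mul_sum, mul_sum]
    _ ≤ 3 * ∑ j ∈ range d, ∫ ω, (A j - μ[A j|F (j + 1)]) ω ^ 2 ∂μ + 3 * ∫ ω, (μ[S|F 0] - A 0) ω ^ 2 ∂μ +
          3 * d * ∑ m ∈ range d, ∫ ω, (μ[A m|F (m + 1)] - A (m + 1)) ω ^ 2 ∂μ := by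
          have := mul_le_mul_of_nonneg_left hdouble (by norm_num : (0 : ℝ) ≤ 3)
          rw [mul_assoc]
          linarith [mul_le_mul_of_nonneg_left hres (by norm_num : (0 : ℝ) ≤ 3)]

include hF hFle hSb hAm hAb in
/-- **THE MEAN TERM WITH A PREDICTOR.**  At depth `d` (DICTIONARY: the unit layer, conditional on the label):
`∫ (μ[S|F d])² ≤ 3∫ (A d)² + 3∫ (μ[resid 0 | F d])² + 3d·Σ_{m<d} ∫ (μ[defect m | F d])²` — the structured predictor's
square, plus the squared depth-`d` conditional MEANS of the initial residual and of each defect (DICTIONARY: each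
vanishes at a flat unit field by covariance, term by term, and is curvature-suppressed — BOOKING-H §5). [folklore] -/
theorem integral_condExp_sq_le_three [IsFiniteMeasure μ] (d : ℕ) :
    ∫ ω, (μ[S|F d]) ω ^ 2 ∂μ ≤ 3 * ∫ ω, A d ω ^ 2 ∂μ + 3 * ∫ ω, (μ[(μ[S|F 0] - A 0) | F d]) ω ^ 2 ∂μ +
      3 * d * ∑ m ∈ range d, ∫ ω, (μ[(μ[A m|F (m + 1)] - A (m + 1)) | F d]) ω ^ 2 ∂μ := by
  have hr := resid_ae_eq_sum (μ := μ) (S := S) hF hFle hAm hAb d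
  have hIA : Integrable (fun ω => A d ω ^ 2) μ :=
    integrable_sq_of_ae_abs_le ((hAm d).mono (hFle d)).aestronglyMeasurable (ae_of_all μ (hAb d))
  have hIr : Integrable (fun ω => (μ[(μ[S|F 0] - A 0) | F d]) ω ^ 2) μ :=
    integrable_sq_of_ae_abs_le (stronglyMeasurable_condExp.mono (hFle d)).aestronglyMeasurable
      (ae_bdd_abs_condExp_of_ae_bdd_abs (ae_abs_resid_zero_le hSb hAb))
  have hIx : ∀ m, Integrable (fun ω => (μ[(μ[A m|F (m + 1)] - A (m + 1)) | F d]) ω ^ 2) μ := fun m =>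
    integrable_sq_of_ae_abs_le (stronglyMeasurable_condExp.mono (hFle d)).aestronglyMeasurable
      (ae_bdd_abs_condExp_of_ae_bdd_abs (ae_abs_defect_le hAb m))
  have hIS : Integrable (fun ω => (μ[S|F d]) ω ^ 2) μ :=
    integrable_sq_of_ae_abs_le (stronglyMeasurable_condExp.mono (hFle d)).aestronglyMeasurable
      (ae_abs_condExp_le hSb)
  have hIsum : Integrable (fun ω => ∑ m ∈ range d, (μ[(μ[A m|F (m + 1)] - A (m + 1)) | F d]) ω ^ 2) μ :=
    integrable_finsetSum _ fun m _ => hIx m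
  have hpt : ∀ᵐ ω ∂μ, (μ[S|F d]) ω ^ 2 ≤ 3 * A d ω ^ 2 + 3 * (μ[(μ[S|F 0] - A 0) | F d]) ω ^ 2 +
      3 * (d * ∑ m ∈ range d, (μ[(μ[A m|F (m + 1)] - A (m + 1)) | F d]) ω ^ 2) := by
    filter_upwards [hr] with ω e
    have eS : μ[S|F d] ω = A d ω + (μ[S|F d] - A d) ω := by rw [Pi.sub_apply, add_sub_cancel]
    simp only [Pi.add_apply, Finset.sum_apply] at e
    rw [eS, e]
    have hcs : (∑ m ∈ range d, (μ[(μ[A m|F (m + 1)] - A (m + 1)) | F d]) ω) ^ 2 ≤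
        d * ∑ m ∈ range d, (μ[(μ[A m|F (m + 1)] - A (m + 1)) | F d]) ω ^ 2 := by
      have h := sq_sum_le_card_mul_sum_sq (s := range d) (f := fun m => (μ[(μ[A m|F (m + 1)] - A (m + 1)) | F d]) ω)
      rwa [card_range] at h
    have h3 : ∀ a b c : ℝ, (a + b + c) ^ 2 ≤ 3 * (a ^ 2 + b ^ 2 + c ^ 2) := fun a b c => by
      nlinarith [sq_nonneg (a - b), sq_nonneg (b - c), sq_nonneg (a - c)]
    nlinarith [h3 (A d ω) ((μ[(μ[S|F 0] - A 0) | F d]) ω)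
      (∑ m ∈ range d, (μ[(μ[A m|F (m + 1)] - A (m + 1)) | F d]) ω), hcs]
  have hA : Integrable (fun ω => 3 * A d ω ^ 2 + 3 * (μ[(μ[S|F 0] - A 0) | F d]) ω ^ 2) μ :=
    (hIA.const_mul 3).add (hIr.const_mul 3)
  have hB : Integrable (fun ω => 3 * ((d : ℝ) * ∑ m ∈ range d, (μ[(μ[A m|F (m + 1)] - A (m + 1)) | F d]) ω ^ 2)) μ :=
    (hIsum.const_mul _).const_mul 3
  have e1 : ∫ ω, (3 * A d ω ^ 2 + 3 * (μ[(μ[S|F 0] - A 0) | F d]) ω ^ 2 +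
      3 * ((d : ℝ) * ∑ m ∈ range d, (μ[(μ[A m|F (m + 1)] - A (m + 1)) | F d]) ω ^ 2)) ∂μ =
      ∫ ω, (3 * A d ω ^ 2 + 3 * (μ[(μ[S|F 0] - A 0) | F d]) ω ^ 2) ∂μ +
      ∫ ω, 3 * ((d : ℝ) * ∑ m ∈ range d, (μ[(μ[A m|F (m + 1)] - A (m + 1)) | F d]) ω ^ 2) ∂μ := integral_add hA hB
  have e2 : ∫ ω, (3 * A d ω ^ 2 + 3 * (μ[(μ[S|F 0] - A 0) | F d]) ω ^ 2) ∂μ =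
      ∫ ω, 3 * A d ω ^ 2 ∂μ + ∫ ω, 3 * (μ[(μ[S|F 0] - A 0) | F d]) ω ^ 2 ∂μ :=
    integral_add (hIA.const_mul 3) (hIr.const_mul 3)
  have e3 : ∫ ω, (d : ℝ) * ∑ m ∈ range d, (μ[(μ[A m|F (m + 1)] - A (m + 1)) | F d]) ω ^ 2 ∂μ =
      (d : ℝ) * ∑ m ∈ range d, ∫ ω, (μ[(μ[A m|F (m + 1)] - A (m + 1)) | F d]) ω ^ 2 ∂μ := by
    rw [integral_const_mul, integral_finsetSum _ fun m _ => hIx m]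
  calc ∫ ω, (μ[S|F d]) ω ^ 2 ∂μ
        ≤ ∫ ω, (3 * A d ω ^ 2 + 3 * (μ[(μ[S|F 0] - A 0) | F d]) ω ^ 2 +
            3 * ((d : ℝ) * ∑ m ∈ range d, (μ[(μ[A m|F (m + 1)] - A (m + 1)) | F d]) ω ^ 2)) ∂μ :=
          integral_mono_ae hIS (hA.add hB) hpt
    _ = _ := by
          rw [e1, e2, integral_const_mul, integral_const_mul, integral_const_mul, e3]
          ring

end Absorption

/-! ## §2 The layer-SUM form of the L¹ bound (all that `OldLayerDatum.bracket` uses) -/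

section SumForm

/-- **FROM A LAYER-SUM BUDGET TO L¹** (probability space): budgets for the noise, for the SUM of the `J` layers and for
the depth-`J` mean give `∫|S| ≤ √(vNoise + V + mMean)` — so `absorption`'s right side may serve as the layer part of
an `OldLayerDatum` bracket (take `vLayer j := ∫ (incr S j)²` verbatim and bound the bracket). [folklore] -/
theorem integral_abs_le_sqrt_of_sumLayerBudget [IsProbabilityMeasure μ] (hF : Antitone F) (hFle : ∀ j, F j ≤ mΩ)
    {S : Ω → ℝ} (hSm : AEStronglyMeasurable S μ) {B : ℝ} (hSb : ∀ ω, |S ω| ≤ B) (J : ℕ)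
    {vNoise V mMean : ℝ} (hnoise : ∫ ω, (S ω - μ[S|F 0] ω) ^ 2 ∂μ ≤ vNoise)
    (hlayers : ∑ j ∈ range J, ∫ ω, incr μ F S j ω ^ 2 ∂μ ≤ V) (hmean : ∫ ω, (μ[S|F J]) ω ^ 2 ∂μ ≤ mMean) :
    ∫ ω, |S ω| ∂μ ≤ Real.sqrt (vNoise + V + mMean) := by
  refine (integral_abs_le_sqrt_integral_sq hSm hSb).trans (Real.sqrt_le_sqrt ?_)
  rw [integral_sq_eq_noise_add_layers_add_mean hF hFle hSm hSb J]
  exact add_le_add (add_le_add hnoise hlayers) hmean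

/-- **NODE Q.old WITH ABSORPTION (one age, probability space):** with a structured predictor `A` and budgets
`∫ (cfluct A j)² ≤ v j` (one-step Poincaré × oscillation profile of the STRUCTURED function), `∫ (resid 0)² ≤ r`,
`∫ (defect m)² ≤ x m` (birth second moments), the noise and mean budgets as before:
`∫|S| ≤ √(vNoise + (3Σ_{j<J} v j + 3r + 3J·Σ_{m<J} x m) + mMean)`. [folklore] -/
theorem integral_abs_le_sqrt_of_absorption [IsProbabilityMeasure μ] (hF : Antitone F) (hFle : ∀ j, F j ≤ mΩ)
    {S : Ω → ℝ} (hSm : AEStronglyMeasurable S μ) {B : ℝ} (hSb : ∀ ω, |S ω| ≤ B) {A : ℕ → Ω → ℝ}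
    (hAm : ∀ j, StronglyMeasurable[F j] (A j)) {R : ℝ} (hAb : ∀ j ω, |A j ω| ≤ R) (J : ℕ)
    {vNoise mMean r : ℝ} {v x : ℕ → ℝ} (hnoise : ∫ ω, (S ω - μ[S|F 0] ω) ^ 2 ∂μ ≤ vNoise)
    (hv : ∀ j < J, ∫ ω, (A j - μ[A j|F (j + 1)]) ω ^ 2 ∂μ ≤ v j) (hr : ∫ ω, (μ[S|F 0] - A 0) ω ^ 2 ∂μ ≤ r)
    (hx : ∀ m < J, ∫ ω, (μ[A m|F (m + 1)] - A (m + 1)) ω ^ 2 ∂μ ≤ x m) (hmean : ∫ ω, (μ[S|F J]) ω ^ 2 ∂μ ≤ mMean) :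
    ∫ ω, |S ω| ∂μ ≤ Real.sqrt (vNoise + (3 * ∑ j ∈ range J, v j + 3 * r + 3 * J * ∑ m ∈ range J, x m) + mMean) := by
  refine integral_abs_le_sqrt_of_sumLayerBudget hF hFle hSm hSb J hnoise ?_ hmean
  refine (absorption (μ := μ) hF hFle hSb hAm hAb J).trans ?_
  have h1 : ∑ j ∈ range J, ∫ ω, (A j - μ[A j|F (j + 1)]) ω ^ 2 ∂μ ≤ ∑ j ∈ range J, v j :=
    sum_le_sum fun j hj => hv j (mem_range.mp hj)
  have h2 : ∑ m ∈ range J, ∫ ω, (μ[A m|F (m + 1)] - A (m + 1)) ω ^ 2 ∂μ ≤ ∑ m ∈ range J, x m :=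
    sum_le_sum fun m hm => hx m (mem_range.mp hm)
  have hJ : (0 : ℝ) ≤ 3 * J := by positivity
  nlinarith [mul_le_mul_of_nonneg_left h2 hJ]

end SumForm

end Summit.QuantumFields.BalabanUV.T4Continuum.NE7LawLevel

end
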